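import Mathlib.LinearAlgebra.Dimension.RankNullity
import Mathlib.LinearAlgebra.Matrix.Determinant.Basic
import Mathlib.LinearAlgebra.Determinant
import Mathlib.LinearAlgebra.Charpoly.BaseChange
import Literature.AlgebraicGeometry.Motives.FaltingsECSemisimpleProofs
import Literature.NumberTheory.EllipticCurves.TateModuleFixedPointsProofs
import Literature.NumberTheory.EllipticCurves.TateModuleDeterminantProofs
import Literature.NumberTheory.EllipticCurves.GaloisActionProofs
import Literature.NumberTheory.EllipticCurves.HasseWeilAbelianConductorProofs
import Literature.NumberTheory.EllipticCurves.BSDConductorIdealFormProofs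
import Literature.NumberTheory.GaloisRepresentations.TameInertiaProofs
import Literature.NumberTheory.GaloisRepresentations.ModPGaloisRepProofs
import Literature.NumberTheory.GaloisRepresentations.RamificationFiltrationProofs
import HarnessLib

/-!
# Unipotent inertia is tame: `Sw_𝔓(V_ℓ E) = 0` at the multiplicative places from Thm. IV.10.2(a)

Sibling proof file (theorems only) for the named fact
`WeierstrassCurve.swanConductorAt_rationalTate_eq_zero_of_hasMultiplicativeReductionAt`
of `HasseWeilAbelianConductor` — Silverman, *ATAEC*, Thm. IV.10.2(b), multiplicative case:
*"If `E/K` has good or multiplicative reduction … then `δ(E/K) = 0`"* (PDF p. 358), i.e. `V_ℓ E`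
is tamely ramified at the places `v ∤ ℓ` of multiplicative reduction — one of the four bad-place
leaves under the C15 fact `artinConductorExponent_tate_eq_conductorExponent_of_isElliptic` and
hence under bsd.S15 `Literature.NumberTheory.EllipticCurves.conductor_eq_conductorOf_mul`.

The printed proof (PDF pp. 359–360) goes through the Tate curve (V.5.3, Ex. 5.11).  This file
proves the leaf **from Thm. IV.10.2(a), multiplicative case**
(`codimFixed_inertia_rationalTate_eq_one_of_hasMultiplicativeReductionAt`: `(V_ℓ E)^{I_𝔓}` is a
line) **and the Weil pairings** (`WeierstrassCurve.exists_weilPairing W (ℓ^(n+1))`, Silverman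
*AEC* III.8.1, through the tree's `det ρ_{E,ℓ} = χ_ℓ`, `det_galoisRepTate_eq_cyclotomicCharacter`),
by the standard unipotence argument, entirely inside the tree's Galois-representation API:

1. `LinearMap.sub_mem_span_of_det_eq_one`: a determinant-`1` endomorphism of a plane fixing a
   non-zero vector `e` moves every vector by a multiple of `e`; with `det ρ_V(σ) = χ_ℓ(σ) = 1` for
   `σ ∈ I_𝔓`, `𝔓 ∤ ℓ` (`det_rationalTateRepresentation_eq_one_of_mem_inertia`, from
   `smul_eq_self_of_mem_inertia_of_pow_prime_pow_eq_one`: inertia prime to `ℓ` fixes `μ_{ℓ^∞}`),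
   the inertia group acts **unipotently**: `(σ - 1)(τ - 1) = 0` on `T_ℓ E` for `σ, τ ∈ I_𝔓`
   (`smul_sub_eq_of_forall_sub_mem_span`, using `T_ℓ E ↪ V_ℓ E`).
2. `Literature.NumberTheory.EllipticCurves.isPGroup_map_absUpperRamificationSubgroup` (number-field analogue of the tree's local
   `absUpperInertia_map_isPGroup_holds`): for `u > 0` the image of the absolute upper ramification
   group `Γ_K^u(𝔓)` in any discrete group is a `p`-group, `p` the residue characteristic of `v`
   (finite level: `G^u ≤ G_1`, `upperRamificationSubgroup_le_ramificationSubgroup_one`, and `G_1`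
   is a `p`-group, `Ideal.isPGroup_ramificationSubgroup_one`, Serre *Local Fields* IV §2 Cor. 3).
3. On `T_ℓ E / 𝔪^n T_ℓ E` (Mathlib `Representation.quotient`; the kernel of this finite-level
   action is open, `isOpen_stabilizer_point_holds`) a unipotent `σ` has order dividing `ℓ^n`
   (`quotient_galoisRepTate_pow_eq_one`: `(1 + N)^{ℓ^n} = 1 + ℓ^n N`,
   `one_add_pow_eq_of_mul_self_eq_zero`) and, for `σ ∈ Γ_K^u(𝔓)`, `u > 0`, also `p`-power order;
   as `p ≠ ℓ` it acts trivially at every level, hence trivially on `T_ℓ E` (`ℓ`-adic separation,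
   `TateModule.instIsHausdorff`) and on `V_ℓ E`:
   `isTameAt_rationalTate_of_exists_fixed_of_det_eq_one`, so `Sw_𝔓(V_ℓ E) = 0`
   (`GaloisRep.IsTameAt.swanConductorAt_eq_zero`).

Consequences: `swanConductorAt_rationalTate_eq_zero_of_codimFixed_le_one` (`codim (V_ℓ E)^{I_𝔓} ≤ 1`
and the Weil pairings give `Sw_𝔓 = 0`), and the reduction of the leaf to Thm. IV.10.2(a) and the
Weil pairings,
`swanConductorAt_rationalTate_eq_zero_of_hasMultiplicativeReductionAt_of_codim_of_weilPairing`;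
whence the C15 fact for semistable curves from the single multiplicative-place fact
`codimFixed_inertia_rationalTate_eq_one_of_hasMultiplicativeReductionAt` and the Weil pairings
(`artinConductorExponent_tate_eq_conductorExponent_of_isSemistable_of_codim_of_weilPairing`), and
in general from three leaves and the Weil pairings
(`artinConductorExponent_tate_eq_conductorExponent_of_isElliptic_of_codim_of_ogg_of_weilPairing`);
over `ℚ`, the corresponding reductions of bsd.S15 (d) `Literature.NumberTheory.EllipticCurves.conductor_eq_conductorOf_mul`
(`Literature.NumberTheory.EllipticCurves.conductor_eq_conductorOf_mul_of_isSemistable_of_codim_of_weilPairing`,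
`Literature.NumberTheory.EllipticCurves.conductor_eq_conductorOf_mul_of_codim_of_ogg_of_weilPairing`, through
`BSDConductorIdealFormProofs`).

## References

* J. H. Silverman, *Advanced Topics in the Arithmetic of Elliptic Curves*, GTM 151 (1994), §IV.10,
  Thm. 10.2(a),(b) (PDF pp. 358–360). [SilvermanATAEC1994]
* J.-P. Serre, *Local Fields*, GTM 67 (1979), Ch. IV §2, Cor. 3 of Prop. 7 (`G_1` is a
  `p`-group) and §3, Remark 1 (upper numbering of `Gal(K̄/K)`). [SerreLocalFields1979]
* J. H. Silverman, *The Arithmetic of Elliptic Curves*, 2nd ed. (2009), Prop. III.8.1, III.8.3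
  (Weil pairing, `det ρ_ℓ = χ_ℓ`). [SilvermanAEC2009]
* J.-P. Serre, J. Tate, *Good reduction of abelian varieties*, Ann. of Math. 88 (1968), §1–§3.
  [SerreTate1968]
-/

noncomputable section

open scoped Classical AddSubgroup NumberField
open Field IsDedekindDomain

universe u

namespace Literature.NumberTheory.EllipticCurves

/-! ### Two algebraic lemmas -/

/-- `(1 + N)^m = 1 + m N` for `N² = 0` (binomial theorem with only two surviving terms). [folklore] -/
theorem one_add_pow_eq_of_mul_self_eq_zero {R : Type*} [Ring R] {N : R} (hN : N * N = 0) (m : ℕ) :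
    (1 + N) ^ m = 1 + (m : R) * N := by
  induction m with
  | zero => simp
  | succ m ih =>
    rw [pow_succ, ih, add_mul, one_mul, mul_add, mul_one, mul_assoc, hN, mul_zero, add_zero,
      Nat.cast_succ, add_mul, one_mul]
    abel

/-- **A determinant-one endomorphism of a plane fixing a non-zero vector is unipotent**: if
`dim_k V = 2`, `f e = e` with `e ≠ 0` and `det f = 1`, then `f w - w ∈ k e` for every `w` (in a
basis `(e, y)` the matrix of `f` is `[[1, c], [0, det f]]`). [folklore] -/
theorem LinearMap.sub_mem_span_of_det_eq_one {k V : Type*} [Field k] [AddCommGroup V] [Module k V]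
    [FiniteDimensional k V] (h2 : Module.finrank k V = 2) (f : V →ₗ[k] V) {e : V} (he : e ≠ 0)
    (hfe : f e = e) (hdet : LinearMap.det f = 1) (w : V) : f w - w ∈ k ∙ e := by
  obtain ⟨y, hli⟩ := exists_linearIndependent_pair_of_one_lt_finrank (h2 ▸ one_lt_two) he
  let b : Module.Basis (Fin 2) k V :=
    basisOfLinearIndependentOfCardEqFinrank hli (by rw [Fintype.card_fin, h2])
  have hb0 : b 0 = e := by
    simp [b, coe_basisOfLinearIndependentOfCardEqFinrank]
  have hb1 : b 1 = y := by
    simp [b, coe_basisOfLinearIndependentOfCardEqFinrank]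
  -- the matrix of `f`: first column `(1, 0)`, so `det f = M 1 1`
  have hM00 : LinearMap.toMatrix b b f 0 0 = 1 := by
    rw [LinearMap.toMatrix_apply, hb0, hfe, ← hb0, b.repr_self, Finsupp.single_eq_same]
  have hM10 : LinearMap.toMatrix b b f 1 0 = 0 := by
    rw [LinearMap.toMatrix_apply, hb0, hfe, ← hb0, b.repr_self,
      Finsupp.single_eq_of_ne (by decide)]
  have hM11 : b.repr (f y) 1 = 1 := by
    have h := LinearMap.det_toMatrix b f
    rw [Matrix.det_fin_two, hM00, hM10, one_mul, mul_zero, sub_zero, hdet,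
      LinearMap.toMatrix_apply, hb1] at h
    exact h
  -- `f y = c • e + y`
  have hfy : f y - y ∈ k ∙ e := by
    have hsum := b.sum_repr (f y)
    rw [Fin.sum_univ_two, hb0, hb1, hM11, one_smul] at hsum
    rw [Submodule.mem_span_singleton]
    exact ⟨b.repr (f y) 0, by rw [eq_sub_iff_add_eq, hsum]⟩
  -- general `w = a • e + d • y`
  have hw := b.sum_repr w
  rw [Fin.sum_univ_two, hb0, hb1] at hw
  rw [← hw, map_add, map_smul, map_smul, hfe]
  have : b.repr w 0 • e + b.repr w 1 • f y - (b.repr w 0 • e + b.repr w 1 • y) =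
      b.repr w 1 • (f y - y) := by
    rw [smul_sub]; abel
  rw [this]
  exact Submodule.smul_mem _ _ hfy

/-! ### Wild ramification groups of a number field have `p`-group images -/

section NumberFieldWild

variable {K : Type u} [Field K] [NumberField K]

/-- The Galois group of a finite subextension `E/K` of `K̄` acts faithfully on the integral closure
of `𝓞 K` in `E` (every element of `E` becomes integral after multiplication by a non-zero
algebraic integer).  The `Algebra (𝓞 K) E` structure is a variable so that the lemma applies to the
structure hidden in `IntermediateField.integralClosureToAbsIntegers`.  Number-field analogue of the
tree's `faithfulSMul_algEquiv_integralClosure_intermediateField`.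
Ref: Serre, *Local Fields*, Ch. I §4. [folklore] -/
theorem faithfulSMul_algEquiv_integralClosure_ringOfIntegers
    (E : IntermediateField K (AlgebraicClosure K)) [FiniteDimensional K E]
    [alg : Algebra (𝓞 K) E] [IsScalarTower (𝓞 K) K E] :
    FaithfulSMul (E ≃ₐ[K] E) (integralClosure (𝓞 K) E) := by
  refine ⟨fun {σ τ} h => AlgEquiv.ext fun y => ?_⟩
  have halg : IsAlgebraic (𝓞 K) y :=
    (IsFractionRing.isAlgebraic_iff (𝓞 K) K E).mpr (Algebra.IsAlgebraic.isAlgebraic y)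
  obtain ⟨a, ha, hint⟩ := halg.exists_integral_multiple
  have hx := h ⟨a • y, hint⟩
  have hx' : σ (a • y) = τ (a • y) := congrArg Subtype.val hx
  rw [Algebra.smul_def, map_mul, map_mul, IsScalarTower.algebraMap_apply (𝓞 K) K E,
    AlgEquiv.commutes, AlgEquiv.commutes] at hx'
  have ha' : algebraMap K E (algebraMap (𝓞 K) K a) ≠ 0 := by
    rw [map_ne_zero, map_ne_zero_iff _ (IsFractionRing.injective (𝓞 K) K)]
    exact ha
  exact mul_left_cancel₀ ha' hx'

/-- The integral closure of `𝓞 K` in a finite subextension `E/K` of `K̄` is a noetherian ring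
(a finite `𝓞 K`-module, `IsIntegralClosure.isNoetherian`).  Ref: Serre, *Local Fields*, Ch. I §4,
Prop. 8. [folklore] -/
theorem isNoetherianRing_integralClosure_ringOfIntegers
    (E : IntermediateField K (AlgebraicClosure K)) [FiniteDimensional K E]
    [alg : Algebra (𝓞 K) E] [IsScalarTower (𝓞 K) K E] :
    IsNoetherianRing (integralClosure (𝓞 K) E) := by
  have h : IsNoetherian (𝓞 K) (integralClosure (𝓞 K) E) :=
    IsIntegralClosure.isNoetherian (𝓞 K) K E (integralClosure (𝓞 K) E)
  exact isNoetherian_of_tower (𝓞 K) h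

/-- **The wild inertia group of a finite Galois `E/K` at a prime above `v` is a `p`-group**, `p`
the residue characteristic of `v`: for `𝔓` a prime of `\bar ℤ_K` above the finite place `v` of the
number field `K` and `𝔓_E = 𝔓 ∩ E`, the first ramification group `G_1` of `Gal(E/K)` at `𝔓_E` is a
`p`-group (`Ideal.isPGroup_ramificationSubgroup_one` with `p ∈ v ⊆ 𝔓_E`).
Ref: Serre, *Local Fields*, Ch. IV §2, Cor. 3 of Prop. 7.
[cite: SerreLocalFields1979, Ch. IV §2 Cor. 3 of Prop. 7] -/
theorem isPGroup_ramificationSubgroup_one_of_mem_primesAbove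
    {v : HeightOneSpectrum (𝓞 K)} {𝔓 : Ideal (GaloisRepresentations.absIntegers (𝓞 K) K)} (h𝔓 : 𝔓 ∈ v.primesAbove)
    (E : IntermediateField K (AlgebraicClosure K)) [FiniteDimensional K E] [IsGalois K E] :
    IsPGroup (ringChar (𝓞 K ⧸ v.asIdeal))
      ((𝔓.comap (E.integralClosureToAbsIntegers (𝓞 K))).ramificationSubgroup (E ≃ₐ[K] E) 1) := by
  haveI : 𝔓.IsPrime := h𝔓.1
  -- the instances are supplied by unification (the `Algebra (𝓞 K) E` structure hidden in the
  -- integral closure is `IntermediateField.algebra'`, not the `NumberField` default)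
  refine @Ideal.isPGroup_ramificationSubgroup_one _ _ _ (E ≃ₐ[K] E) _ _ _
    (isNoetherianRing_integralClosure_ringOfIntegers E) _
    (faithfulSMul_algEquiv_integralClosure_ringOfIntegers E)
    (Ideal.comap_ne_top _ Ideal.IsPrime.ne_top') _ ?_
  rw [Ideal.mem_comap, map_natCast]
  -- `p ∈ v ⊆ 𝔓`
  have hp : ((ringChar (𝓞 K ⧸ v.asIdeal) : 𝓞 K)) ∈ v.asIdeal := by
    rw [← Ideal.Quotient.eq_zero_iff_mem, map_natCast]
    exact ringChar.Nat.cast_ringChar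
  have hp' := h𝔓.2.over.le hp
  rw [Ideal.mem_under, map_natCast] at hp'
  exact hp'

/-- **The image of `Γ_K^u(𝔓)` (`u > 0`) in a discrete group is a `p`-group** (number-field
analogue of the tree's local `absUpperInertia_map_isPGroup_holds`).  For a continuous homomorphism
`f : Γ_K → H` into a discrete group, a prime `𝔓` of `\bar ℤ_K` above the finite place `v` and
`u > 0`, `f(Γ_K^u(𝔓))` is a `p`-group, `p = char (𝓞 K / v)`: `f` factors through a finite Galois
`Gal(E/K)` (`exists_isGalois_ker_le`), the restriction of `σ ∈ Γ_K^u(𝔓)` lies in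
`Gal(E/K)^u ≤ Gal(E/K)_1` (`mem_absUpperRamificationSubgroup_iff`,
`upperRamificationSubgroup_le_ramificationSubgroup_one`), a `p`-group
(`isPGroup_ramificationSubgroup_one_of_mem_primesAbove`).
Ref: Serre, *Local Fields*, Ch. IV §2, Cor. 3 of Prop. 7 and §3, Remark 1.
[cite: SerreLocalFields1979, Ch. IV §2 Cor. 3 of Prop. 7 and §3 Remark 1] -/
theorem isPGroup_map_absUpperRamificationSubgroup {H : Type*} [Group H] [TopologicalSpace H]
    [DiscreteTopology H] (f : absoluteGaloisGroup K →ₜ* H)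
    {v : HeightOneSpectrum (𝓞 K)} {𝔓 : Ideal (GaloisRepresentations.absIntegers (𝓞 K) K)} (h𝔓 : 𝔓 ∈ v.primesAbove)
    {u : ℝ} (hu : 0 < u) :
    IsPGroup (ringChar (𝓞 K ⧸ v.asIdeal))
      ((GaloisRepresentations.absUpperRamificationSubgroup (𝓞 K) 𝔓 u).map f.toMonoidHom) := by
  obtain ⟨E, hfin, hgal, hker⟩ := GaloisRepresentations.exists_isGalois_ker_le K f
  have hG1 := isPGroup_ramificationSubgroup_one_of_mem_primesAbove h𝔓 E
  rintro ⟨_, σ, hσ, rfl⟩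
  have h1 := (GaloisRepresentations.mem_absUpperRamificationSubgroup_iff.mp hσ) E
  have h2 := GaloisRepresentations.upperRamificationSubgroup_le_ramificationSubgroup_one
    (𝔓.comap (E.integralClosureToAbsIntegers (𝓞 K))) (E ≃ₐ[K] E) hu h1
  obtain ⟨t, ht⟩ := hG1 ⟨_, h2⟩
  refine ⟨t, Subtype.ext ?_⟩
  have hmem : σ ^ ringChar (𝓞 K ⧸ v.asIdeal) ^ t ∈ (GaloisRepresentations.absRestrictNormalHom (K := K) E).ker := by
    rw [MonoidHom.mem_ker, map_pow]
    exact congrArg Subtype.val ht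
  have := hker hmem
  rw [MonoidHom.mem_ker, map_pow] at this
  rw [Subgroup.coe_pow, Subgroup.coe_one]
  exact this

end NumberFieldWild

/-- An element of a monoid killed by two coprime exponents is trivial. [folklore] -/
theorem Monoid.eq_one_of_pow_eq_one_of_coprime {M : Type*} [Monoid M] {g : M} {a b : ℕ}
    (ha : g ^ a = 1) (hb : g ^ b = 1) (hab : a.Coprime b) : g = 1 := by
  have h := orderOf_dvd_of_pow_eq_one ha
  have h' := orderOf_dvd_of_pow_eq_one hb
  have : orderOf g ∣ 1 := hab ▸ Nat.dvd_gcd h h'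
  rw [Nat.dvd_one] at this
  exact orderOf_eq_one_iff.mp this

end Literature.NumberTheory.EllipticCurves

/-! ### Unipotent inertia on `T_ℓ E` -/

namespace WeierstrassCurve

open Literature.NumberTheory.EllipticCurves Literature.NumberTheory.GaloisRepresentations

variable {K : Type u} [Field K] (W : WeierstrassCurve K) (ℓ : ℕ) [Fact ℓ.Prime]

/-- An automorphism fixing `E[ℓ^n]` pointwise acts trivially on `T_ℓ E` modulo `𝔪^n T_ℓ E`
(`𝔪 = (ℓ) ⊂ ℤ_ℓ`; `TateModule.mem_pow_smul_top_of_proj_eq_zero`).  Silverman, *AEC*, III.§7.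
[folklore] -/
theorem smul_sub_mem_pow_smul_top_of_forall_smul_eq {σ : absoluteGaloisGroup K} {n : ℕ}
    (hσ : ∀ P : geomPoints W, ℓ ^ n • P = 0 → σ • P = P) (x : W.tateModule ℓ) :
    σ • x - x ∈ (IsLocalRing.maximalIdeal ℤ_[ℓ] ^ n • ⊤ : Submodule ℤ_[ℓ] (W.tateModule ℓ)) :=
  TateModule.mem_pow_smul_top_of_proj_eq_zero (by
    rw [map_sub, TateModule.proj_smul_of_distribMulAction, hσ _ (TateModule.pow_smul_proj n x),
      sub_self])

/-- `𝔪^n T_ℓ E` is stable under the Galois action (any `ℤ_ℓ`-linear map preserves `𝔪^n T`).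
[folklore] -/
theorem pow_smul_top_le_comap_galoisRepTate (σ : absoluteGaloisGroup K) (n : ℕ) :
    (IsLocalRing.maximalIdeal ℤ_[ℓ] ^ n • ⊤ : Submodule ℤ_[ℓ] (W.tateModule ℓ)) ≤
      (IsLocalRing.maximalIdeal ℤ_[ℓ] ^ n • ⊤ : Submodule ℤ_[ℓ] (W.tateModule ℓ)).comap
        (W.galoisRepTate ℓ σ) := by
  rw [← Submodule.map_le_iff_le_comap, Submodule.map_smul'']
  exact Submodule.smul_mono le_rfl le_top

/-- **Unipotence on the lattice.**  If a subgroup `I ≤ Γ_K` fixes a vector `e ∈ V_ℓ E` and every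
`σ ∈ I` moves every vector of `V_ℓ E` by a multiple of `e`, then `σ (τ x - x) = τ x - x` on
`T_ℓ E` for all `σ, τ ∈ I` (`T_ℓ E ↪ V_ℓ E`, `TateModule.toRational_injective`): the operators
`σ - 1`, `σ ∈ I`, have pairwise vanishing products. [folklore] -/
theorem smul_sub_eq_of_forall_sub_mem_span (I : Subgroup (absoluteGaloisGroup K))
    {e : W.rationalTateModule ℓ}
    (he : ∀ σ ∈ I, rationalTateRepresentation (absoluteGaloisGroup K) (geomPoints W) ℓ σ e = e)
    (hspan : ∀ σ ∈ I, ∀ w : W.rationalTateModule ℓ,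
      rationalTateRepresentation (absoluteGaloisGroup K) (geomPoints W) ℓ σ w - w ∈ ℚ_[ℓ] ∙ e)
    {σ τ : absoluteGaloisGroup K} (hσ : σ ∈ I) (hτ : τ ∈ I) (x : W.tateModule ℓ) :
    σ • (τ • x - x) = τ • x - x := by
  apply TateModule.toRational_injective
  set y := τ • x - x with hy
  have hyspan : TateModule.toRational ℓ y ∈ ℚ_[ℓ] ∙ e := by
    rw [hy, map_sub, ← rationalTateRepresentation_toRational]
    exact hspan τ hτ _
  obtain ⟨c, hc⟩ := Submodule.mem_span_singleton.mp hyspan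
  rw [← rationalTateRepresentation_toRational, ← hc, LinearMap.map_smul, he σ hσ]

/-- **A unipotent automorphism of `T_ℓ E` has order dividing `ℓ^n` on `T_ℓ E / 𝔪^n T_ℓ E`**: if
`σ (σ x - x) = σ x - x` for all `x ∈ T_ℓ E`, then the automorphism of `T_ℓ E / 𝔪^n T_ℓ E`
induced by `σ` (Mathlib `Representation.quotient` of `galoisRepTate`) satisfies `σ^{ℓ^n} = 1`
(`(1 + N)^{ℓ^n} = 1 + ℓ^n N` and `ℓ^n` kills `T / 𝔪^n T`). [folklore] -/
theorem quotient_galoisRepTate_pow_eq_one {σ : absoluteGaloisGroup K} (n : ℕ)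
    (hσ : ∀ x : W.tateModule ℓ, σ • (σ • x - x) = σ • x - x) :
    (W.galoisRepTate ℓ).quotient (IsLocalRing.maximalIdeal ℤ_[ℓ] ^ n • ⊤)
        (fun τ ↦ pow_smul_top_le_comap_galoisRepTate W ℓ τ n) σ ^ (ℓ ^ n) = 1 := by
  set Mn : Submodule ℤ_[ℓ] (W.tateModule ℓ) := IsLocalRing.maximalIdeal ℤ_[ℓ] ^ n • ⊤ with hMn
  set u := (W.galoisRepTate ℓ).quotient Mn (fun τ ↦ pow_smul_top_le_comap_galoisRepTate W ℓ τ n) σ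
    with hu
  set N := u - 1 with hN
  have hNapply : ∀ y : W.tateModule ℓ,
      N (Submodule.Quotient.mk y) = Submodule.Quotient.mk (σ • y - y) := fun y ↦ by
    rw [hN, LinearMap.sub_apply, Module.End.one_apply, hu, Representation.quotient_apply,
      Submodule.mapQ_apply, galoisRepTate_apply_apply, Submodule.Quotient.mk_sub]
  have hNN : N * N = 0 := by
    refine LinearMap.ext fun z ↦ ?_
    obtain ⟨y, rfl⟩ := Submodule.Quotient.mk_surjective Mn z
    rw [Module.End.mul_apply, hNapply, hNapply, hσ y, sub_self, Submodule.Quotient.mk_zero,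
      LinearMap.zero_apply]
  have hℓmem : (ℓ : ℤ_[ℓ]) ∈ IsLocalRing.maximalIdeal ℤ_[ℓ] := by
    rw [PadicInt.maximalIdeal_eq_span_p]
    exact Ideal.mem_span_singleton_self _
  have hkill : ∀ z : W.tateModule ℓ ⧸ Mn, (ℓ ^ n : ℕ) • z = 0 := fun z ↦ by
    obtain ⟨y, rfl⟩ := Submodule.Quotient.mk_surjective Mn z
    rw [← Nat.cast_smul_eq_nsmul ℤ_[ℓ], ← Submodule.Quotient.mk_smul, Submodule.Quotient.mk_eq_zero,
      Nat.cast_pow]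
    exact Submodule.smul_mem_smul (Ideal.pow_mem_pow hℓmem n) Submodule.mem_top
  have huN : u = 1 + N := by rw [hN]; abel
  rw [huN, one_add_pow_eq_of_mul_self_eq_zero hNN, add_eq_left]
  refine LinearMap.ext fun z ↦ ?_
  rw [Module.End.mul_apply, Module.End.natCast_apply, hkill, LinearMap.zero_apply]

section NumberField

variable {K : Type u} [Field K] [NumberField K] (W : WeierstrassCurve K) (ℓ : ℕ) [Fact ℓ.Prime]

/-- **Unipotent inertia is tame.**  Let `E/K` be an elliptic curve over a number field, `ℓ` a
prime, `v ∤ ℓ` a finite place and `𝔓 ∣ v` a prime of `\bar ℤ_K`.  If the inertia group `I_𝔓`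
fixes a non-zero vector of `V_ℓ E` and acts with determinant `1`, then `V_ℓ E` is tamely ramified at
`𝔓` (`GaloisRep.IsTameAt`: every `Γ_K^u(𝔓)`, `u > 0`, acts trivially).  Proof: `I_𝔓` acts
unipotently (`LinearMap.sub_mem_span_of_det_eq_one`, `smul_sub_eq_of_forall_sub_mem_span`); on each
`T_ℓ E / 𝔪^n T_ℓ E` an element `σ ∈ Γ_K^u(𝔓) ≤ I_𝔓` (`absUpperRamificationSubgroup_le_inertia_holds`)
then has `ℓ`-power order (`quotient_galoisRepTate_pow_eq_one`) and `p`-power order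
(`Literature.NumberTheory.EllipticCurves.isPGroup_map_absUpperRamificationSubgroup`, the finite-level action being continuous because
its kernel contains the open pointwise fixer of `E[ℓ^n]`, `isOpen_stabilizer_point_holds`), with
`p ≠ ℓ` the residue characteristic of `v`; so it acts trivially at every level, hence on `T_ℓ E`
(`TateModule.instIsHausdorff`) and on `V_ℓ E = ℚ_ℓ ⊗ T_ℓ E`.  This is the mechanism behind
Silverman *ATAEC* Thm. IV.10.2(b), multiplicative case (there via the Tate curve, PDF pp. 359–360).
[cite: SilvermanATAEC1994, Thm. IV.10.2(b) (PDF pp. 358–360)]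
[cite: SerreLocalFields1979, Ch. IV §2 Cor. 3 of Prop. 7 and §3 Remark 1] -/
theorem isTameAt_rationalTate_of_exists_fixed_of_det_eq_one [W.IsElliptic]
    (h : Continuous fun x : absoluteGaloisGroup K × RationalTateModule (geomPoints W) ℓ ↦
      rationalTateRepresentation (absoluteGaloisGroup K) (geomPoints W) ℓ x.1 x.2)
    {v : HeightOneSpectrum (𝓞 K)} (hℓ : (ℓ : 𝓞 K) ∉ v.asIdeal)
    {𝔓 : Ideal (absIntegers (𝓞 K) K)} (h𝔓 : 𝔓 ∈ v.primesAbove)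
    (he : ∃ e : W.rationalTateModule ℓ, e ≠ 0 ∧ ∀ σ ∈ 𝔓.inertia (absoluteGaloisGroup K),
      rationalTateRepresentation (absoluteGaloisGroup K) (geomPoints W) ℓ σ e = e)
    (hdet : ∀ σ ∈ 𝔓.inertia (absoluteGaloisGroup K),
      LinearMap.det (rationalTateRepresentation (absoluteGaloisGroup K) (geomPoints W) ℓ σ) = 1) :
    (rationalTateGaloisRepOf (geomPoints W) ℓ h).IsTameAt (𝓞 K) 𝔓 := by
  intro u hu σ hσu
  have hσI : σ ∈ 𝔓.inertia (absoluteGaloisGroup K) :=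
    absUpperRamificationSubgroup_le_inertia_holds (𝓞 K) 𝔓 u hσu
  obtain ⟨e, he0, he⟩ := he
  have hℓK : (ℓ : K) ≠ 0 := Nat.cast_ne_zero.mpr (Fact.out : ℓ.Prime).ne_zero
  have h2 : Module.finrank ℚ_[ℓ] (W.rationalTateModule ℓ) = 2 :=
    finrank_rationalTateModule_eq_two_holds W ℓ hℓK
  haveI : FiniteDimensional ℚ_[ℓ] (W.rationalTateModule ℓ) := finite_rationalTateModule W ℓ
  -- every `τ ∈ I` moves vectors by multiples of `e`
  have hspan : ∀ τ ∈ 𝔓.inertia (absoluteGaloisGroup K), ∀ w : W.rationalTateModule ℓ,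
      rationalTateRepresentation (absoluteGaloisGroup K) (geomPoints W) ℓ τ w - w ∈ ℚ_[ℓ] ∙ e :=
    fun τ hτ w ↦ LinearMap.sub_mem_span_of_det_eq_one h2 _ he0 (he τ hτ) (hdet τ hτ) w
  -- unipotence on the lattice
  have hunip : ∀ τ ∈ 𝔓.inertia (absoluteGaloisGroup K), ∀ x : W.tateModule ℓ,
      τ • (τ • x - x) = τ • x - x :=
    fun τ hτ x ↦ smul_sub_eq_of_forall_sub_mem_span W ℓ _ he hspan hτ hτ x
  -- it suffices that `σ` acts trivially on `T_ℓ E`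
  suffices hT : ∀ x : W.tateModule ℓ, σ • x = x by
    refine LinearMap.ext fun w ↦ ?_
    obtain ⟨N, hN, x, hx⟩ := RationalTateModule.exists_smul_eq_toRational w
    have hN' : (N : ℚ_[ℓ]) ≠ 0 := PadicInt.coe_ne_zero.mpr hN
    apply smul_right_injective (W.rationalTateModule ℓ) hN'
    change (N : ℚ_[ℓ]) • rationalTateRepresentation (absoluteGaloisGroup K) (geomPoints W) ℓ σ w =
      (N : ℚ_[ℓ]) • w
    rw [← LinearMap.map_smul_of_tower, hx, rationalTateRepresentation_toRational, hT]
  intro x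
  refine (IsHausdorff.eq_iff_smodEq (I := IsLocalRing.maximalIdeal ℤ_[ℓ])).mpr fun n ↦ ?_
  rw [SModEq.sub_mem]
  -- the level-`n` representation on `T / 𝔪^n T`
  set Mn : Submodule ℤ_[ℓ] (W.tateModule ℓ) := IsLocalRing.maximalIdeal ℤ_[ℓ] ^ n • ⊤ with hMn
  let ρn : Representation ℤ_[ℓ] (absoluteGaloisGroup K) (W.tateModule ℓ ⧸ Mn) :=
    (W.galoisRepTate ℓ).quotient Mn (fun τ ↦ pow_smul_top_le_comap_galoisRepTate W ℓ τ n)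
  have hρn : ∀ (τ : absoluteGaloisGroup K) (y : W.tateModule ℓ),
      ρn τ (Submodule.Quotient.mk y) = Submodule.Quotient.mk (τ • y) := fun τ y ↦ by
    simp only [ρn, Representation.quotient_apply, Submodule.mapQ_apply, galoisRepTate_apply_apply]
  -- (a) `ρn σ` has `ℓ`-power order
  have hℓpow : ρn σ ^ (ℓ ^ n) = 1 := quotient_galoisRepTate_pow_eq_one W ℓ n (hunip σ hσI)
  -- (b) `ρn σ` has `p`-power order, `p` the residue characteristic of `v`
  set p := ringChar (𝓞 K ⧸ v.asIdeal) with hp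
  have hppow : ∃ t : ℕ, ρn σ ^ (p ^ t) = 1 := by
    let H := (Module.End ℤ_[ℓ] (W.tateModule ℓ ⧸ Mn))ˣ
    letI : TopologicalSpace H := ⊥
    haveI : DiscreteTopology H := ⟨rfl⟩
    let f₀ : absoluteGaloisGroup K →* H := (ρn : absoluteGaloisGroup K →* _).toHomUnits
    have hf₀ : ∀ τ, ((f₀ τ : H) : Module.End ℤ_[ℓ] (W.tateModule ℓ ⧸ Mn)) = ρn τ := fun τ ↦ rfl
    -- the kernel is open: it contains the pointwise fixer of `E[ℓ^n]`
    have hker : IsOpen ((f₀.ker : Subgroup (absoluteGaloisGroup K)) : Set (absoluteGaloisGroup K)) := by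
      have hfin : Finite ((geomPoints W)[(ℓ ^ n : ℕ)]) :=
        finite_torsionPoints_algebraicClosure W
          (by exact_mod_cast pow_ne_zero n (Fact.out : ℓ.Prime).ne_zero)
      refine Subgroup.isOpen_mono
        (H₁ := ⨅ P : (geomPoints W)[(ℓ ^ n : ℕ)],
          MulAction.stabilizer (absoluteGaloisGroup K) (P : geomPoints W)) ?_ ?_
      · intro τ hτ
        rw [MonoidHom.mem_ker]
        apply Units.ext
        rw [hf₀, Units.val_one]
        have hfix : ∀ P : geomPoints W, ℓ ^ n • P = 0 → τ • P = P := fun P hP ↦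
          (Subgroup.mem_iInf.mp hτ) ⟨P, AddSubgroup.torsionBy.nsmul_iff.mpr hP⟩
        refine LinearMap.ext fun z ↦ ?_
        obtain ⟨y, rfl⟩ := Submodule.Quotient.mk_surjective Mn z
        rw [hρn, Module.End.one_apply, Submodule.Quotient.eq]
        exact smul_sub_mem_pow_smul_top_of_forall_smul_eq W ℓ hfix y
      · rw [Subgroup.coe_iInf]
        exact isOpen_iInter_of_finite fun P ↦ isOpen_stabilizer_point_holds W (P : geomPoints W)
    -- hence `f₀` is continuous (its fibres are unions of cosets of the kernel)
    have hcont : Continuous f₀ := by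
      refine continuous_def.mpr fun s _ ↦ ?_
      have hs : f₀ ⁻¹' s = ⋃ τ ∈ f₀ ⁻¹' s, (fun κ ↦ τ * κ) '' (f₀.ker : Set (absoluteGaloisGroup K)) := by
        ext τ
        simp only [Set.mem_preimage, Set.mem_iUnion, Set.mem_image, SetLike.mem_coe,
          MonoidHom.mem_ker]
        constructor
        · intro hτ
          exact ⟨τ, hτ, 1, map_one f₀, mul_one τ⟩
        · rintro ⟨τ', hτ', κ, hκ, rfl⟩
          rw [map_mul, hκ, mul_one]
          exact hτ'
      rw [hs]
      exact isOpen_biUnion fun τ _ ↦ (isOpenMap_mul_left τ) _ hker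
    let f : absoluteGaloisGroup K →ₜ* H := ⟨f₀, hcont⟩
    have hPgrp := isPGroup_map_absUpperRamificationSubgroup f h𝔓 hu
    obtain ⟨t, ht⟩ := hPgrp ⟨f₀ σ, Subgroup.mem_map_of_mem f.toMonoidHom hσu⟩
    refine ⟨t, ?_⟩
    have ht' : (f₀ σ) ^ p ^ t = 1 := by
      have := congrArg Subtype.val ht
      rwa [Subgroup.coe_pow, Subgroup.coe_one] at this
    have h3 : ((f₀ σ ^ p ^ t : H) : Module.End ℤ_[ℓ] (W.tateModule ℓ ⧸ Mn)) = ((1 : H) : _) :=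
      congrArg Units.val ht'
    rw [Units.val_pow_eq_pow_val, Units.val_one, hf₀] at h3
    exact h3
  obtain ⟨t, ht⟩ := hppow
  -- (c) the two orders are coprime
  have hpprime : p.Prime := by
    haveI : Finite (𝓞 K ⧸ v.asIdeal) := Ideal.finiteQuotientOfFreeOfNeBot v.asIdeal v.ne_bot
    exact CharP.char_is_prime (𝓞 K ⧸ v.asIdeal) p
  have hpl : p ≠ ℓ := by
    intro hpl
    apply hℓ
    rw [← Ideal.Quotient.eq_zero_iff_mem, map_natCast, ← hpl]
    exact ringChar.Nat.cast_ringChar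
  have hcop : (ℓ ^ n).Coprime (p ^ t) :=
    Nat.Coprime.pow _ _ ((Nat.coprime_primes Fact.out hpprime).mpr (Ne.symm hpl))
  have h1 : ρn σ = 1 := Monoid.eq_one_of_pow_eq_one_of_coprime hℓpow ht hcop
  have := LinearMap.congr_fun h1 (Submodule.Quotient.mk x)
  rw [hρn, Module.End.one_apply, Submodule.Quotient.eq] at this
  exact this

/-- `Sw_𝔓(V_ℓ E) = 0` under the hypotheses of
`isTameAt_rationalTate_of_exists_fixed_of_det_eq_one` (`GaloisRep.IsTameAt.swanConductorAt_eq_zero`).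
[cite: SilvermanATAEC1994, Thm. IV.10.2(b) (PDF pp. 358–360)] -/
theorem swanConductorAt_rationalTate_eq_zero_of_exists_fixed_of_det_eq_one [W.IsElliptic]
    (h : Continuous fun x : absoluteGaloisGroup K × RationalTateModule (geomPoints W) ℓ ↦
      rationalTateRepresentation (absoluteGaloisGroup K) (geomPoints W) ℓ x.1 x.2)
    {v : HeightOneSpectrum (𝓞 K)} (hℓ : (ℓ : 𝓞 K) ∉ v.asIdeal)
    {𝔓 : Ideal (absIntegers (𝓞 K) K)} (h𝔓 : 𝔓 ∈ v.primesAbove)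
    (he : ∃ e : W.rationalTateModule ℓ, e ≠ 0 ∧ ∀ σ ∈ 𝔓.inertia (absoluteGaloisGroup K),
      rationalTateRepresentation (absoluteGaloisGroup K) (geomPoints W) ℓ σ e = e)
    (hdet : ∀ σ ∈ 𝔓.inertia (absoluteGaloisGroup K),
      LinearMap.det (rationalTateRepresentation (absoluteGaloisGroup K) (geomPoints W) ℓ σ) = 1) :
    (rationalTateGaloisRepOf (geomPoints W) ℓ h).swanConductorAt (𝓞 K) 𝔓 = 0 :=
  (W.isTameAt_rationalTate_of_exists_fixed_of_det_eq_one ℓ h hℓ h𝔓 he hdet).swanConductorAt_eq_zero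

/-- **`det ρ_{E,ℓ}(σ) = 1` for `σ` in an inertia group prime to `ℓ`**, granted the Weil pairings
on `E[ℓ^n]`, `n ≥ 1` (named facts `exists_weilPairing W (ℓ^(n+1))`, Silverman *AEC* III.8.1):
`det ρ_V(σ) = det ρ_T(σ) = χ_ℓ(σ)` (`LinearMap.det_baseChange`,
`det_galoisRepTate_eq_cyclotomicCharacter`) and `χ_ℓ(σ) = 1` because inertia prime to `ℓ` fixes the
`ℓ`-power roots of unity (`smul_eq_self_of_mem_inertia_of_pow_prime_pow_eq_one`,
`cyclotomicCharacter_eq_one_of_forall_pow_eq_one`).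
[cite: SilvermanAEC2009, Prop. III.8.1 and Prop. III.8.3] -/
theorem det_rationalTateRepresentation_eq_one_of_mem_inertia [W.IsElliptic]
    (hW : ∀ n : ℕ, W.exists_weilPairing (ℓ ^ (n + 1)))
    {v : HeightOneSpectrum (𝓞 K)} (hℓ : (ℓ : 𝓞 K) ∉ v.asIdeal)
    {𝔓 : Ideal (absIntegers (𝓞 K) K)} (h𝔓 : 𝔓 ∈ v.primesAbove)
    {σ : absoluteGaloisGroup K} (hσ : σ ∈ 𝔓.inertia (absoluteGaloisGroup K)) :
    LinearMap.det (rationalTateRepresentation (absoluteGaloisGroup K) (geomPoints W) ℓ σ) = 1 := by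
  have hℓK : (ℓ : K) ≠ 0 := Nat.cast_ne_zero.mpr (Fact.out : ℓ.Prime).ne_zero
  haveI := module_free_tateModule_holds W ℓ
  haveI := module_finite_tateModule_holds W ℓ
  have hχ : GaloisRep.cyclotomicCharacter K ℓ σ = 1 := by
    rw [GaloisRep.cyclotomicCharacter_apply]
    refine cyclotomicCharacter_eq_one_of_forall_pow_eq_one ℓ _ fun n t ht ↦ ?_
    exact smul_eq_self_of_mem_inertia_of_pow_prime_pow_eq_one hℓ h𝔓 hσ ht
  change LinearMap.det ((W.galoisRepTate ℓ σ).baseChange ℚ_[ℓ]) = 1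
  rw [LinearMap.det_baseChange, det_galoisRepTate_eq_cyclotomicCharacter W ℓ hℓK hW σ, hχ,
    Units.val_one, map_one]

/-- If `codim (V_ℓ E)^I ≤ 1` then `I` fixes a non-zero vector of `V_ℓ E` (`dim V_ℓ E = 2`,
`finrank_rationalTateModule_eq_two_holds`; `ContinuousRep.codimFixed_eq_finrank_sub`). [folklore] -/
theorem exists_ne_zero_fixed_of_codimFixed_le_one [W.IsElliptic]
    (h : Continuous fun x : absoluteGaloisGroup K × RationalTateModule (geomPoints W) ℓ ↦
      rationalTateRepresentation (absoluteGaloisGroup K) (geomPoints W) ℓ x.1 x.2)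
    (I : Subgroup (absoluteGaloisGroup K))
    (hcodim : (rationalTateGaloisRepOf (geomPoints W) ℓ h).codimFixed I ≤ 1) :
    ∃ e : W.rationalTateModule ℓ, e ≠ 0 ∧ ∀ σ ∈ I,
      rationalTateRepresentation (absoluteGaloisGroup K) (geomPoints W) ℓ σ e = e := by
  have hℓK : (ℓ : K) ≠ 0 := Nat.cast_ne_zero.mpr (Fact.out : ℓ.Prime).ne_zero
  have h2 : Module.finrank ℚ_[ℓ] (W.rationalTateModule ℓ) = 2 :=
    finrank_rationalTateModule_eq_two_holds W ℓ hℓK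
  haveI : FiniteDimensional ℚ_[ℓ] (W.rationalTateModule ℓ) := finite_rationalTateModule W ℓ
  have hpos : 1 ≤ Module.finrank ℚ_[ℓ] ((rationalTateGaloisRepOf (geomPoints W) ℓ h).fixedSubmodule I) := by
    have := (rationalTateGaloisRepOf (geomPoints W) ℓ h).codimFixed_eq_finrank_sub I
    change _ = Module.finrank ℚ_[ℓ] (W.rationalTateModule ℓ) - _ at this
    omega
  obtain ⟨e, he, he0⟩ := Submodule.exists_mem_ne_zero_of_ne_bot
    ((Submodule.one_le_finrank_iff).mp hpos)
  exact ⟨e, he0, fun σ hσ ↦ ((ContinuousRep.mem_fixedSubmodule _ I e).mp he) σ hσ⟩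

/-- **`Sw_𝔓(V_ℓ E) = 0` from `codim (V_ℓ E)^{I_𝔓} ≤ 1` and the Weil pairings** (`v ∤ ℓ`, `𝔓 ∣ v`):
`isTameAt_rationalTate_of_exists_fixed_of_det_eq_one` with
`exists_ne_zero_fixed_of_codimFixed_le_one` and `det_rationalTateRepresentation_eq_one_of_mem_inertia`.
[cite: SilvermanATAEC1994, Thm. IV.10.2(b) (PDF pp. 358–360)] -/
theorem swanConductorAt_rationalTate_eq_zero_of_codimFixed_le_one [W.IsElliptic]
    (h : Continuous fun x : absoluteGaloisGroup K × RationalTateModule (geomPoints W) ℓ ↦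
      rationalTateRepresentation (absoluteGaloisGroup K) (geomPoints W) ℓ x.1 x.2)
    (hW : ∀ n : ℕ, W.exists_weilPairing (ℓ ^ (n + 1)))
    {v : HeightOneSpectrum (𝓞 K)} (hℓ : (ℓ : 𝓞 K) ∉ v.asIdeal)
    {𝔓 : Ideal (absIntegers (𝓞 K) K)} (h𝔓 : 𝔓 ∈ v.primesAbove)
    (hcodim : (rationalTateGaloisRepOf (geomPoints W) ℓ h).codimFixed
      (𝔓.inertia (absoluteGaloisGroup K)) ≤ 1) :
    (rationalTateGaloisRepOf (geomPoints W) ℓ h).swanConductorAt (𝓞 K) 𝔓 = 0 :=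
  W.swanConductorAt_rationalTate_eq_zero_of_exists_fixed_of_det_eq_one ℓ h hℓ h𝔓
    (W.exists_ne_zero_fixed_of_codimFixed_le_one ℓ h _ hcodim)
    (fun _ hσ ↦ W.det_rationalTateRepresentation_eq_one_of_mem_inertia ℓ hW hℓ h𝔓 hσ)

/-- **Silverman *ATAEC* Thm. IV.10.2(b), multiplicative case, from Thm. IV.10.2(a) and the Weil
pairing.**  The named fact `swanConductorAt_rationalTate_eq_zero_of_hasMultiplicativeReductionAt W ℓ`
(`Sw_𝔓(V_ℓ E) = 0` at the places `v ∤ ℓ` of multiplicative reduction) follows from the named fact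
`codimFixed_inertia_rationalTate_eq_one_of_hasMultiplicativeReductionAt W ℓ` (10.2(a):
`codim (V_ℓ E)^{I_𝔓} = 1` there) and the Weil pairings `exists_weilPairing W (ℓ^(n+1))`, `n ≥ 0`
(*AEC* III.8.1) — replacing the Tate-curve input of the printed proof (PDF pp. 359–360).
[cite: SilvermanATAEC1994, Thm. IV.10.2(b) (PDF pp. 358–360)] -/
theorem swanConductorAt_rationalTate_eq_zero_of_hasMultiplicativeReductionAt_of_codim_of_weilPairing
    (hTm : W.codimFixed_inertia_rationalTate_eq_one_of_hasMultiplicativeReductionAt ℓ)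
    (hW : ∀ n : ℕ, W.exists_weilPairing (ℓ ^ (n + 1))) :
    W.swanConductorAt_rationalTate_eq_zero_of_hasMultiplicativeReductionAt ℓ := by
  intro _ h v hℓ hv 𝔓 h𝔓
  exact W.swanConductorAt_rationalTate_eq_zero_of_codimFixed_le_one ℓ h hW hℓ h𝔓
    (hTm h v hℓ hv h𝔓).le

/-- **The C15 fact for semistable curves from Thm. IV.10.2(a) and the Weil pairing.**  For a
semistable `W` (good or multiplicative reduction everywhere), Ogg–Saito in Galois form,
`artinConductorExponent_tate_eq_conductorExponent_of_isElliptic W ℓ`, follows from the single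
multiplicative-place fact `codimFixed_inertia_rationalTate_eq_one_of_hasMultiplicativeReductionAt W ℓ`
and the Weil pairings (through
`artinConductorExponent_tate_eq_conductorExponent_of_isElliptic_of_isSemistable` of
`HasseWeilAbelianConductorProofs`).
[cite: SilvermanATAEC1994, Thm. IV.10.2 and Example 10.5 (PDF pp. 358–364)] -/
theorem artinConductorExponent_tate_eq_conductorExponent_of_isSemistable_of_codim_of_weilPairing
    (hs : W.IsSemistable (𝓞 K))
    (hTm : W.codimFixed_inertia_rationalTate_eq_one_of_hasMultiplicativeReductionAt ℓ)
    (hW : ∀ n : ℕ, W.exists_weilPairing (ℓ ^ (n + 1))) :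
    W.artinConductorExponent_tate_eq_conductorExponent_of_isElliptic ℓ :=
  W.artinConductorExponent_tate_eq_conductorExponent_of_isElliptic_of_isSemistable ℓ hs hTm
    (W.swanConductorAt_rationalTate_eq_zero_of_hasMultiplicativeReductionAt_of_codim_of_weilPairing
      ℓ hTm hW)

/-- **The C15 fact from Thm. IV.10.2(a), Ogg's formula at the additive places, and the Weil
pairing**: Ogg–Saito in Galois form, `artinConductorExponent_tate_eq_conductorExponent_of_isElliptic W ℓ`,
follows from the two tame leaves (`codim (V_ℓ E)^{I_𝔓} = 1`, resp. `2`, at the multiplicative,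
resp. additive places), Ogg's formula for the wild part at the additive places, and the Weil
pairings — the fourth leaf, Thm. IV.10.2(b) at the multiplicative places, being supplied by
`swanConductorAt_rationalTate_eq_zero_of_hasMultiplicativeReductionAt_of_codim_of_weilPairing`.
[cite: SilvermanATAEC1994, Thm. IV.10.2 and Thm. IV.11.1 (PDF pp. 358–366)] -/
theorem artinConductorExponent_tate_eq_conductorExponent_of_isElliptic_of_codim_of_ogg_of_weilPairing
    (hTm : W.codimFixed_inertia_rationalTate_eq_one_of_hasMultiplicativeReductionAt ℓ)
    (hTa : W.codimFixed_inertia_rationalTate_eq_two_of_hasAdditiveReductionAt ℓ)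
    (hWa : W.swanConductorAt_rationalTate_eq_wildConductorExponent_of_hasAdditiveReductionAt ℓ)
    (hW : ∀ n : ℕ, W.exists_weilPairing (ℓ ^ (n + 1))) :
    W.artinConductorExponent_tate_eq_conductorExponent_of_isElliptic ℓ :=
  W.artinConductorExponent_tate_eq_conductorExponent_of_isElliptic_of_facts ℓ hTm hTa
    (W.swanConductorAt_rationalTate_eq_zero_of_hasMultiplicativeReductionAt_of_codim_of_weilPairing
      ℓ hTm hW) hWa

end NumberField

end WeierstrassCurve

/-! ### Over `ℚ`: bsd.S15 (d) from the reduced set of leaves -/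

namespace Literature.NumberTheory.EllipticCurves

open WeierstrassCurve

variable (W : WeierstrassCurve ℚ) (ℓ : ℕ) [Fact ℓ.Prime]

/-- **bsd.S15 (d), ideal form, for semistable curves, from Thm. IV.10.2(a) and the Weil
pairing.**  For a semistable elliptic `W / ℚ` and a prime `ℓ`,
`Literature.BSD.conductor_eq_conductorOf_mul W ℓ` (`𝔣(E/ℚ) = 𝔣^{(ℓ)}(V_ℓ E) · v_ℓ^{f_ℓ}`) follows from the
multiplicative-place tame fact `codimFixed_inertia_rationalTate_eq_one_of_hasMultiplicativeReductionAt W ℓ`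
(Silverman *ATAEC* Thm. IV.10.2(a)) and the Weil pairings `exists_weilPairing W (ℓ^(n+1))`
(*AEC* III.8.1), through `conductor_eq_conductorOf_mul_of_isElliptic_of_tate` and
`artinConductorExponent_tate_eq_conductorExponent_of_isSemistable_of_codim_of_weilPairing`.
[cite: SilvermanATAEC1994, Thm. IV.10.2 and Example 10.5 (PDF pp. 358–364), with §IV.10 Definition (p. 364)] -/
theorem conductor_eq_conductorOf_mul_of_isSemistable_of_codim_of_weilPairing [W.IsElliptic]
    (hs : W.IsSemistable (𝓞 ℚ))
    (hTm : W.codimFixed_inertia_rationalTate_eq_one_of_hasMultiplicativeReductionAt ℓ)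
    (hW : ∀ n : ℕ, W.exists_weilPairing (ℓ ^ (n + 1))) :
    conductor_eq_conductorOf_mul W ℓ :=
  conductor_eq_conductorOf_mul_of_isElliptic_of_tate W ℓ
    (W.artinConductorExponent_tate_eq_conductorExponent_of_isSemistable_of_codim_of_weilPairing ℓ
      hs hTm hW)

/-- **bsd.S15 (d), ideal form, from three leaves and the Weil pairing.**  For an elliptic `W / ℚ`
and a prime `ℓ`, `Literature.BSD.conductor_eq_conductorOf_mul W ℓ` follows from Silverman *ATAEC*
Thm. IV.10.2(a) at the multiplicative and additive places (`hTm`, `hTa`), Ogg's formula for the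
wild part at the additive places (`hWa`) and the Weil pairings (`hW`), the multiplicative wild leaf
(Thm. IV.10.2(b)) being the theorem
`swanConductorAt_rationalTate_eq_zero_of_hasMultiplicativeReductionAt_of_codim_of_weilPairing`.
[cite: SilvermanATAEC1994, Thm. IV.10.2 and Thm. IV.11.1 (PDF pp. 358–366), with §IV.10 Definition (p. 364)] -/
theorem conductor_eq_conductorOf_mul_of_codim_of_ogg_of_weilPairing [W.IsElliptic]
    (hTm : W.codimFixed_inertia_rationalTate_eq_one_of_hasMultiplicativeReductionAt ℓ)
    (hTa : W.codimFixed_inertia_rationalTate_eq_two_of_hasAdditiveReductionAt ℓ)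
    (hWa : W.swanConductorAt_rationalTate_eq_wildConductorExponent_of_hasAdditiveReductionAt ℓ)
    (hW : ∀ n : ℕ, W.exists_weilPairing (ℓ ^ (n + 1))) :
    conductor_eq_conductorOf_mul W ℓ :=
  conductor_eq_conductorOf_mul_of_isElliptic_of_tate W ℓ
    (W.artinConductorExponent_tate_eq_conductorExponent_of_isElliptic_of_codim_of_ogg_of_weilPairing
      ℓ hTm hTa hWa hW)

end Literature.NumberTheory.EllipticCurves
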